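import Summits.Ventures.Crystal3D.Theorems.StickyWulffConstantNoReconstructionGainCellFluxIsolated
import HarnessLib

/-!
# CELLFLUX `d = 12` stratum: the window of `TwelveCodeCovering` is `(1/(2a₀), 7√3/18]`

HONEST FRAMING. Part of the venture `Summits/Ventures/Crystal3D` (cell `crystal3d-full`), helper
`--supports` the crux `NoReconstructionGain` (stmt-Ventures-19144, route
`route-Ventures-StickyWulffConstant`), CELLFLUX architecture γ (planner cf-p1 g15; landed glue
`twelveOfCovering`: `(∃ c > 1/(2a), TwelveCodeCovering c) → LocalFluxBoundAt a 1 12`).  This file is the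
kernel port of planner cf-p2 g13's record R28-Q12 (`HOME/cf-p2/jobs/r28-q12/lean/TwelveCode.lean`, rc 0,
written against copies of the definitions; here against the LANDED `CellFlux.TwelveCodeCovering`,
`CellFlux.fluxRadius`):

* the C2v twelve-point kissing code in exact closed form — `A = (±2√6/9, ±1/2, 7√3/18)`, `B = (0, ±1, 0)`,
  `C = (±√6/3, ±1/2, −√3/6)`, `D = (0, ±1/2, −√3/2)` (23 contacts; all 132 ordered pairs at distance `≥ 1`
  by exact rational arithmetic on `6Δa² + Δb² + 3Δc²`) — has the hole `e₃` of angular radius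
  `arccos(7√3/18) = 47.6564°`: every code point has `⟪e₃, w⟫ ≤ 7√3/18`;
* hence **`not_twelveCodeCovering_of_lt : 7√3/18 < c → ¬ TwelveCodeCovering c`** and
  `le_of_twelveCodeCovering`;
* `one_div_two_mul_fluxRadius_lt : 1/(2·fluxRadius) < 7√3/18` (`⟺ 27π < 49√3`; margin `1.8·10⁻³`), so the
  hypothesis of `TwelveOfCovering fluxRadius` is not refuted: it holds iff `TwelveCodeCovering c` for some
  `c` in the window `(1/(2a₀), 7√3/18]` (`twelveCodeCovering_window`).  cf-p1 g16's sharp target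
  (ROUTE §69): Conjecture Q₁₂ = `TwelveCodeCovering (7√3/18)`.

WHAT THIS IS NOT: the covering bound itself (a Tammes-type certificate, open); not `LocalFluxBoundAt a₀ 1 12`;
rung F-C1 not moved.
-/

noncomputable section

namespace Summit.Ventures.Crystal3D.Theorems

open Summit.Ventures.Crystal3D Finset
open Summit.Ventures.Crystal3D.Cruxes.NoReconstructionGain.CellFlux
open scoped InnerProductSpace

/-! ### Code points `(a√6, b, c√3)` with rational `a b c` -/

/-- Squared distance of two code points. -/
theorem dist_codePt_sq (a b c a' b' c' : ℝ) :
    dist (!₂[a * Real.sqrt 6, b, c * Real.sqrt 3] : EuclideanSpace ℝ (Fin 3))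
        !₂[a' * Real.sqrt 6, b', c' * Real.sqrt 3] ^ 2
      = 6 * (a - a') ^ 2 + (b - b') ^ 2 + 3 * (c - c') ^ 2 := by
  have h6sq : Real.sqrt 6 ^ 2 = 6 := Real.sq_sqrt (by norm_num)
  have h3sq : Real.sqrt 3 ^ 2 = 3 := Real.sq_sqrt (by norm_num)
  rw [EuclideanSpace.dist_eq, Real.sq_sqrt (by positivity), Fin.sum_univ_three]
  simp only [Matrix.cons_val_zero, Matrix.cons_val_one, Matrix.cons_val, Real.dist_eq, sq_abs]
  have e1 : (a * Real.sqrt 6 - a' * Real.sqrt 6) ^ 2 = 6 * (a - a') ^ 2 := by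
    rw [show a * Real.sqrt 6 - a' * Real.sqrt 6 = (a - a') * Real.sqrt 6 by ring, mul_pow, h6sq]; ring
  have e2 : (c * Real.sqrt 3 - c' * Real.sqrt 3) ^ 2 = 3 * (c - c') ^ 2 := by
    rw [show c * Real.sqrt 3 - c' * Real.sqrt 3 = (c - c') * Real.sqrt 3 by ring, mul_pow, h3sq]; ring
  rw [e1, e2]

/-- A code-point pair is at distance `≥ 1` once `6Δa² + Δb² + 3Δc² ≥ 1`. -/
theorem one_le_dist_codePt {a b c a' b' c' : ℝ}
    (h : 1 ≤ 6 * (a - a') ^ 2 + (b - b') ^ 2 + 3 * (c - c') ^ 2) :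
    1 ≤ dist (!₂[a * Real.sqrt 6, b, c * Real.sqrt 3] : EuclideanSpace ℝ (Fin 3))
        !₂[a' * Real.sqrt 6, b', c' * Real.sqrt 3] := by
  have hsq := dist_codePt_sq a b c a' b' c'
  nlinarith [dist_nonneg (x := (!₂[a * Real.sqrt 6, b, c * Real.sqrt 3] : EuclideanSpace ℝ (Fin 3)))
    (y := !₂[a' * Real.sqrt 6, b', c' * Real.sqrt 3]), hsq]

/-- Squared norm of a code point. -/
theorem norm_codePt_sq (a b c : ℝ) :
    ‖(!₂[a * Real.sqrt 6, b, c * Real.sqrt 3] : EuclideanSpace ℝ (Fin 3))‖ ^ 2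
      = 6 * a ^ 2 + b ^ 2 + 3 * c ^ 2 := by
  have h6sq : Real.sqrt 6 ^ 2 = 6 := Real.sq_sqrt (by norm_num)
  have h3sq : Real.sqrt 3 ^ 2 = 3 := Real.sq_sqrt (by norm_num)
  rw [EuclideanSpace.norm_eq, Real.sq_sqrt (by positivity), Fin.sum_univ_three]
  simp only [Matrix.cons_val_zero, Matrix.cons_val_one, Matrix.cons_val, Real.norm_eq_abs, sq_abs]
  rw [mul_pow, mul_pow, h6sq, h3sq]; ring

/-- A code point with `6a² + b² + 3c² = 1` is a unit vector. -/
theorem norm_codePt_eq_one {a b c : ℝ} (h : 6 * a ^ 2 + b ^ 2 + 3 * c ^ 2 = 1) :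
    ‖(!₂[a * Real.sqrt 6, b, c * Real.sqrt 3] : EuclideanSpace ℝ (Fin 3))‖ = 1 := by
  have hsq : ‖(!₂[a * Real.sqrt 6, b, c * Real.sqrt 3] : EuclideanSpace ℝ (Fin 3))‖ ^ 2 = 1 := by
    rw [norm_codePt_sq]; exact h
  nlinarith [norm_nonneg (!₂[a * Real.sqrt 6, b, c * Real.sqrt 3] : EuclideanSpace ℝ (Fin 3)), hsq]

/-- Inner product of a code point with `e₃ = (0,0,1)`. -/
theorem inner_e3_codePt (a b c : ℝ) :
    ⟪(!₂[0, 0, 1] : EuclideanSpace ℝ (Fin 3)), !₂[a * Real.sqrt 6, b, c * Real.sqrt 3]⟫_ℝ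
      = c * Real.sqrt 3 := by
  rw [PiLp.inner_apply, Fin.sum_univ_three]
  simp

/-- A code point with `c ≤ 7/18` lies outside the open cap of angular radius `arccos (7√3/18)` about `e₃`. -/
theorem inner_e3_codePt_le {a b c : ℝ} (h : c ≤ 7 / 18) :
    ⟪(!₂[0, 0, 1] : EuclideanSpace ℝ (Fin 3)), !₂[a * Real.sqrt 6, b, c * Real.sqrt 3]⟫_ℝ
      ≤ 7 * Real.sqrt 3 / 18 := by
  have h3 : 0 < Real.sqrt 3 := Real.sqrt_pos.mpr (by norm_num)
  rw [inner_e3_codePt]; nlinarith [h3, h]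

/-- `‖(0,0,1)‖ = 1`. -/
theorem norm_vec001 : ‖(!₂[0, 0, 1] : EuclideanSpace ℝ (Fin 3))‖ = 1 := by
  rw [EuclideanSpace.norm_eq, Fin.sum_univ_three]; simp

/-! ### The exact C2v code (cf-p2 R28-Q12) -/

/-- Every point of the C2v code is a unit vector. -/
theorem c2vCode_norm (f : Fin 12 → EuclideanSpace ℝ (Fin 3))
    (hf : f = ![!₂[2/9 * Real.sqrt 6, 1/2, 7/18 * Real.sqrt 3], !₂[-2/9 * Real.sqrt 6, 1/2, 7/18 * Real.sqrt 3],
      !₂[-2/9 * Real.sqrt 6, -1/2, 7/18 * Real.sqrt 3], !₂[2/9 * Real.sqrt 6, -1/2, 7/18 * Real.sqrt 3],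
      !₂[0 * Real.sqrt 6, 1, 0 * Real.sqrt 3], !₂[0 * Real.sqrt 6, -1, 0 * Real.sqrt 3],
      !₂[1/3 * Real.sqrt 6, 1/2, -1/6 * Real.sqrt 3], !₂[-1/3 * Real.sqrt 6, 1/2, -1/6 * Real.sqrt 3],
      !₂[-1/3 * Real.sqrt 6, -1/2, -1/6 * Real.sqrt 3], !₂[1/3 * Real.sqrt 6, -1/2, -1/6 * Real.sqrt 3],
      !₂[0 * Real.sqrt 6, 1/2, -1/2 * Real.sqrt 3], !₂[0 * Real.sqrt 6, -1/2, -1/2 * Real.sqrt 3]])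
    (i : Fin 12) : ‖f i‖ = 1 := by
  subst hf
  fin_cases i <;> (apply norm_codePt_eq_one; norm_num)

/-- The C2v code is a kissing code: all 132 ordered pairs of distinct points are at distance `≥ 1`
(exact rational checks `6Δa² + Δb² + 3Δc² ≥ 1`; 23 of the 66 pairs are contacts). -/
theorem c2vCode_dist (f : Fin 12 → EuclideanSpace ℝ (Fin 3))
    (hf : f = ![!₂[2/9 * Real.sqrt 6, 1/2, 7/18 * Real.sqrt 3], !₂[-2/9 * Real.sqrt 6, 1/2, 7/18 * Real.sqrt 3],
      !₂[-2/9 * Real.sqrt 6, -1/2, 7/18 * Real.sqrt 3], !₂[2/9 * Real.sqrt 6, -1/2, 7/18 * Real.sqrt 3],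
      !₂[0 * Real.sqrt 6, 1, 0 * Real.sqrt 3], !₂[0 * Real.sqrt 6, -1, 0 * Real.sqrt 3],
      !₂[1/3 * Real.sqrt 6, 1/2, -1/6 * Real.sqrt 3], !₂[-1/3 * Real.sqrt 6, 1/2, -1/6 * Real.sqrt 3],
      !₂[-1/3 * Real.sqrt 6, -1/2, -1/6 * Real.sqrt 3], !₂[1/3 * Real.sqrt 6, -1/2, -1/6 * Real.sqrt 3],
      !₂[0 * Real.sqrt 6, 1/2, -1/2 * Real.sqrt 3], !₂[0 * Real.sqrt 6, -1/2, -1/2 * Real.sqrt 3]])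
    (i j : Fin 12) (hij : i ≠ j) : 1 ≤ dist (f i) (f j) := by
  subst hf
  fin_cases i <;> fin_cases j <;>
    first | exact absurd rfl hij | (apply one_le_dist_codePt; norm_num)

/-- Every point of the C2v code has `⟪e₃, w⟫ ≤ 7√3/18` (the hole at `e₃`). -/
theorem c2vCode_inner (f : Fin 12 → EuclideanSpace ℝ (Fin 3))
    (hf : f = ![!₂[2/9 * Real.sqrt 6, 1/2, 7/18 * Real.sqrt 3], !₂[-2/9 * Real.sqrt 6, 1/2, 7/18 * Real.sqrt 3],
      !₂[-2/9 * Real.sqrt 6, -1/2, 7/18 * Real.sqrt 3], !₂[2/9 * Real.sqrt 6, -1/2, 7/18 * Real.sqrt 3],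
      !₂[0 * Real.sqrt 6, 1, 0 * Real.sqrt 3], !₂[0 * Real.sqrt 6, -1, 0 * Real.sqrt 3],
      !₂[1/3 * Real.sqrt 6, 1/2, -1/6 * Real.sqrt 3], !₂[-1/3 * Real.sqrt 6, 1/2, -1/6 * Real.sqrt 3],
      !₂[-1/3 * Real.sqrt 6, -1/2, -1/6 * Real.sqrt 3], !₂[1/3 * Real.sqrt 6, -1/2, -1/6 * Real.sqrt 3],
      !₂[0 * Real.sqrt 6, 1/2, -1/2 * Real.sqrt 3], !₂[0 * Real.sqrt 6, -1/2, -1/2 * Real.sqrt 3]])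
    (i : Fin 12) : ⟪(!₂[0, 0, 1] : EuclideanSpace ℝ (Fin 3)), f i⟫_ℝ ≤ 7 * Real.sqrt 3 / 18 := by
  subst hf
  fin_cases i <;> (apply inner_e3_codePt_le; norm_num)

/-! ### The window of `TwelveCodeCovering` -/

/-- **`TwelveCodeCovering c` fails for every `c > 7√3/18 = 0.67358`** (cf-p2 R28-Q12), witnessed by the
exact C2v code and the hole direction `e₃`. -/
theorem not_twelveCodeCovering_of_lt {c : ℝ} (hc : 7 * Real.sqrt 3 / 18 < c) :
    ¬ Summit.Ventures.Crystal3D.Cruxes.NoReconstructionGain.CellFlux.TwelveCodeCovering c := by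
  intro h
  set f : Fin 12 → EuclideanSpace ℝ (Fin 3) :=
    ![!₂[2/9 * Real.sqrt 6, 1/2, 7/18 * Real.sqrt 3], !₂[-2/9 * Real.sqrt 6, 1/2, 7/18 * Real.sqrt 3],
      !₂[-2/9 * Real.sqrt 6, -1/2, 7/18 * Real.sqrt 3], !₂[2/9 * Real.sqrt 6, -1/2, 7/18 * Real.sqrt 3],
      !₂[0 * Real.sqrt 6, 1, 0 * Real.sqrt 3], !₂[0 * Real.sqrt 6, -1, 0 * Real.sqrt 3],
      !₂[1/3 * Real.sqrt 6, 1/2, -1/6 * Real.sqrt 3], !₂[-1/3 * Real.sqrt 6, 1/2, -1/6 * Real.sqrt 3],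
      !₂[-1/3 * Real.sqrt 6, -1/2, -1/6 * Real.sqrt 3], !₂[1/3 * Real.sqrt 6, -1/2, -1/6 * Real.sqrt 3],
      !₂[0 * Real.sqrt 6, 1/2, -1/2 * Real.sqrt 3], !₂[0 * Real.sqrt 6, -1/2, -1/2 * Real.sqrt 3]] with hf
  have hnorm : ∀ i, ‖f i‖ = 1 := c2vCode_norm f hf
  have hdist : ∀ i j, i ≠ j → 1 ≤ dist (f i) (f j) := c2vCode_dist f hf
  have hinner : ∀ i, ⟪(!₂[0, 0, 1] : EuclideanSpace ℝ (Fin 3)), f i⟫_ℝ ≤ 7 * Real.sqrt 3 / 18 :=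
    c2vCode_inner f hf
  have hinj : Function.Injective f := by
    intro i j hij
    by_contra hne
    have h1 := hdist i j hne
    rw [hij, dist_self] at h1
    norm_num at h1
  set W : Finset (EuclideanSpace ℝ (Fin 3)) := univ.image f with hW
  have hcard : W.card = 12 := by
    rw [hW, card_image_of_injective _ hinj]; simp
  have hn : ∀ w ∈ W, ‖w‖ = 1 := by
    intro w hw
    obtain ⟨i, -, rfl⟩ := mem_image.mp hw
    exact hnorm i
  have hd : ∀ v ∈ W, ∀ w ∈ W, v ≠ w → 1 ≤ ‖v - w‖ := by
    intro v hv w hw hne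
    obtain ⟨i, -, rfl⟩ := mem_image.mp hv
    obtain ⟨j, -, rfl⟩ := mem_image.mp hw
    have hij : i ≠ j := fun e => hne (by rw [e])
    rw [← dist_eq_norm]
    exact hdist i j hij
  obtain ⟨w, hw, hcw⟩ := h W hcard hn hd _ norm_vec001
  obtain ⟨i, -, rfl⟩ := mem_image.mp hw
  linarith [hinner i]

/-- Consequently any valid covering constant satisfies `c ≤ 7√3/18`. -/
theorem le_of_twelveCodeCovering {c : ℝ}
    (h : Summit.Ventures.Crystal3D.Cruxes.NoReconstructionGain.CellFlux.TwelveCodeCovering c) :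
    c ≤ 7 * Real.sqrt 3 / 18 :=
  not_lt.mp fun hc => not_twelveCodeCovering_of_lt hc h

/-- **The window is non-empty**: `1/(2·fluxRadius) < 7√3/18`, equivalently `27π < 49√3`
(`π < 3.14335`; margin `1.8·10⁻³`). -/
theorem one_div_two_mul_fluxRadius_lt : 1 / (2 * fluxRadius) < 7 * Real.sqrt 3 / 18 := by
  have hpi : Real.pi < 3.141593 := Real.pi_lt_d6
  have hpi0 : 0 < Real.pi := Real.pi_pos
  have h3 : (1.73205 : ℝ) < Real.sqrt 3 := by
    rw [Real.lt_sqrt (by norm_num)]; norm_num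
  have hasq : fluxRadius ^ 2 = Real.sqrt 3 / Real.pi := fluxRadius_sq
  have ha0' : 0 ≤ fluxRadius := fluxRadius_nonneg
  have hprod : fluxRadius ^ 2 * Real.pi = Real.sqrt 3 := by rw [hasq]; field_simp
  have hasq_lb : 0.55132 < fluxRadius ^ 2 := by
    by_contra hle
    push Not at hle
    have : fluxRadius ^ 2 * Real.pi ≤ 0.55132 * 3.141593 :=
      calc fluxRadius ^ 2 * Real.pi ≤ 0.55132 * Real.pi := mul_le_mul_of_nonneg_right hle hpi0.le
        _ ≤ 0.55132 * 3.141593 := mul_le_mul_of_nonneg_left hpi.le (by norm_num)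
    rw [hprod] at this
    linarith
  have ha_lb : 0.7425 < fluxRadius := by nlinarith [hasq_lb, ha0']
  have h1 : 1 / (2 * fluxRadius) < 1 / 1.485 := by
    apply one_div_lt_one_div_of_lt (by norm_num); linarith
  calc 1 / (2 * fluxRadius) < 1 / 1.485 := h1
    _ < 7 * 1.73205 / 18 := by norm_num
    _ ≤ 7 * Real.sqrt 3 / 18 := by nlinarith [h3]

/-- The hypothesis of `TwelveOfCovering fluxRadius` pins the covering constant into the window
`(1/(2a₀), 7√3/18]` (width `1.9·10⁻⁴`): it holds iff `TwelveCodeCovering c` for some such `c`. -/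
theorem twelveCodeCovering_window :
    (∃ c, 1 / (2 * fluxRadius) < c ∧
        Summit.Ventures.Crystal3D.Cruxes.NoReconstructionGain.CellFlux.TwelveCodeCovering c) ↔
      ∃ c, 1 / (2 * fluxRadius) < c ∧ c ≤ 7 * Real.sqrt 3 / 18 ∧
        Summit.Ventures.Crystal3D.Cruxes.NoReconstructionGain.CellFlux.TwelveCodeCovering c :=
  ⟨fun ⟨c, h1, h2⟩ => ⟨c, h1, le_of_twelveCodeCovering h2, h2⟩, fun ⟨c, h1, _, h2⟩ => ⟨c, h1, h2⟩⟩

end Summit.Ventures.Crystal3D.Theorems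

end
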